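import Literature.AlgebraicGeometry.Motives.SpanCInvariantForms
import Literature.AlgebraicGeometry.Motives.HodgeTensorHomProofs
import Mathlib.Algebra.Lie.BaseChange
import Mathlib.RingTheory.Flat.Basic
import HarnessLib

/-!
# `𝔏_ℂ = spanC 𝔏 ⊆ 𝔤𝔩_ℂ(V_ℂ)` IS the base change `ℂ ⊗_ℚ 𝔏`: a Lie algebra isomorphism `ℂ ⊗_ℚ 𝔏 ≃ₗ⁅ℂ⁆ 𝔏'`

Family `hodge`, layer `Literature/AlgebraicGeometry/Motives`; THEOREMS ONLY (no definition, no named fact; D-0026).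
Written for the cell `pub-hodge-ring2` (literature lane gen 67, programme R44, file F3f: transport between the tree's concrete
complexification `hodgeLieC = spanC hodgeLie ⊆ End_ℂ(V_ℂ)` of `Lie Hg` and Mathlib's abstract base change `ℂ ⊗[ℚ] 𝔏`
(`Mathlib.Algebra.Lie.BaseChange`), so that base-change theorems — semisimplicity (`KillingBaseChange`), the centroid under
extension of scalars (`CentroidBaseChange`), generalized-eigenspace uniformity (`CharpolyOfIrreducibleMinpoly`) — apply to
`Lie Hg ⊗ ℂ`; honest framing of that cell: research route conditional on HC_CM; not a corollary; Q11.4-sentence-2 already refuted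
in dim ≥ 3 — this file is unconditional).

RESULT. **`exists_lieEquiv_baseChange_spanC`** — for a finite-dimensional `ℚ`-space `V`, a Lie subalgebra `𝔏 ≤ 𝔤𝔩_ℚ(V)` and a
Lie subalgebra `𝔏' ≤ 𝔤𝔩_ℂ(V_ℂ)` (commutator brackets) with carrier `spanC 𝔏`, there is an isomorphism of complex Lie algebras
`e : ℂ ⊗_ℚ 𝔏 ≃ 𝔏'` with `e(c ⊗ X) = c · X_ℂ`.  PROOF: the `ℂ`-linear map `c ⊗ X ↦ c · X_ℂ` is `homBaseChange ∘ (1 ⊗ incl)`;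
it is injective (`homBaseChange` is bijective for finite-dimensional `V` — El Zein–Lê §3.1.1.3; `ℂ` is flat over `ℚ`), its
range is `spanC 𝔏` by definition, and it is a Lie homomorphism since `(XY − YX)_ℂ = X_ℂ Y_ℂ − Y_ℂ X_ℂ` (Deligne I §3: extension
of scalars of the rational Lie algebra `Lie Hg`).

## References

* [Deligne1982HodgeCycles] P. Deligne, *Hodge cycles on abelian varieties*, LNM 900 (1982), I §3 (proof of Prop. 3.4: rational
  structures and base change).
* [Jacobson1962LieAlgebras] N. Jacobson, *Lie Algebras* (1962), Ch. X §1 (extension of the base field `𝔏_P = P ⊗ 𝔏`).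
-/

noncomputable section

open scoped TensorProduct

namespace Literature.AlgebraicGeometry.Motives

namespace HodgeStructure

universe u

variable {V : Type u} [AddCommGroup V] [Module ℚ V] [Module.Finite ℚ V]

/-- **`ℂ ⊗_ℚ 𝔏 ≃ₗ⁅ℂ⁆ 𝔏'` for `𝔏'` the complex Lie subalgebra with carrier `spanC 𝔏`**, `c ⊗ X ↦ c · X_ℂ`.
[cite: Deligne1982HodgeCycles, I §3 (proof of Prop. 3.4)] [cite: Jacobson1962LieAlgebras, Ch. X §1] -/
theorem exists_lieEquiv_baseChange_spanC :
    letI : LieRing (Module.End ℚ V) := LieRing.ofAssociativeRing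
    letI : LieRing (Module.End ℂ (ℂ ⊗[ℚ] V)) := LieRing.ofAssociativeRing
    ∀ (𝔏 : LieSubalgebra ℚ (Module.End ℚ V)) (𝔏' : LieSubalgebra ℂ (Module.End ℂ (ℂ ⊗[ℚ] V))),
      𝔏'.toSubmodule = spanC 𝔏.toSubmodule →
      ∃ e : (ℂ ⊗[ℚ] 𝔏) ≃ₗ⁅ℂ⁆ 𝔏', ∀ (c : ℂ) (X : 𝔏),
        ((e (c ⊗ₜ[ℚ] X) : 𝔏') : Module.End ℂ (ℂ ⊗[ℚ] V)) = c • (X : Module.End ℚ V).baseChange ℂ := by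
  letI : LieRing (Module.End ℚ V) := LieRing.ofAssociativeRing
  letI : LieRing (Module.End ℂ (ℂ ⊗[ℚ] V)) := LieRing.ofAssociativeRing
  intro 𝔏 𝔏' h𝔏'
  -- the linear map `c ⊗ X ↦ c • X_ℂ`
  set ι : 𝔏 →ₗ[ℚ] Module.End ℚ V := 𝔏.toSubmodule.subtype with hι
  have hιapply : ∀ X : 𝔏, ι X = (X : Module.End ℚ V) := fun X => rfl
  have hιinj : Function.Injective ι := fun X Y h => Subtype.ext h
  set T₀ : ℂ ⊗[ℚ] 𝔏 →ₗ[ℂ] Module.End ℂ (ℂ ⊗[ℚ] V) := homBaseChange V V ∘ₗ ι.baseChange ℂ with hT₀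
  have hT₀tmul : ∀ (c : ℂ) (X : 𝔏), T₀ (c ⊗ₜ[ℚ] X) = c • (X : Module.End ℚ V).baseChange ℂ := fun c X => by
    rw [hT₀, LinearMap.comp_apply, LinearMap.baseChange_tmul, hιapply, homBaseChange_tmul]
  -- injective
  have hT₀inj : Function.Injective T₀ := by
    rw [hT₀, LinearMap.coe_comp]
    refine (homBaseChange_bijective (V := V) (W := V)).1.comp ?_
    rw [LinearMap.baseChange_eq_ltensor]
    exact Module.Flat.lTensor_preserves_injective_linearMap ι hιinj
  -- range `= spanC 𝔏`
  have hT₀mem : ∀ u, T₀ u ∈ 𝔏' := by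
    intro u
    induction u using TensorProduct.induction_on with
    | zero => rw [map_zero]; exact 𝔏'.zero_mem
    | tmul c X =>
      rw [hT₀tmul, ← LieSubalgebra.mem_toSubmodule, h𝔏']
      exact Submodule.smul_mem _ _ (baseChange_mem_spanC X.2)
    | add u v hu hv => rw [map_add]; exact 𝔏'.add_mem hu hv
  have hT₀surj : ∀ Y : 𝔏', ∃ u, T₀ u = Y := by
    intro Y
    have hY : (Y : Module.End ℂ (ℂ ⊗[ℚ] V)) ∈ spanC 𝔏.toSubmodule := by rw [← h𝔏']; exact Y.2
    unfold spanC at hY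
    refine Submodule.span_induction (p := fun Z _ => ∃ u, T₀ u = Z) ?_ ⟨0, map_zero _⟩ ?_ ?_ hY
    · rintro _ ⟨X, hX, rfl⟩
      exact ⟨(1 : ℂ) ⊗ₜ[ℚ] (⟨X, hX⟩ : 𝔏), by rw [hT₀tmul, one_smul]⟩
    · rintro Z Z' - - ⟨u, rfl⟩ ⟨u', rfl⟩
      exact ⟨u + u', map_add _ _ _⟩
    · rintro c Z - ⟨u, rfl⟩
      exact ⟨c • u, map_smul _ _ _⟩
  -- bracket compatibility of `T₀`
  have hlie : ∀ u v : ℂ ⊗[ℚ] 𝔏, T₀ ⁅u, v⁆ = T₀ u * T₀ v - T₀ v * T₀ u := by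
    intro u v
    induction u using TensorProduct.induction_on with
    | zero => simp only [zero_lie, map_zero, zero_mul, mul_zero, sub_zero]
    | tmul a X =>
      induction v using TensorProduct.induction_on with
      | zero =>
        have h0 : ⁅a ⊗ₜ[ℚ] X, (0 : ℂ ⊗[ℚ] 𝔏)⁆ = 0 := lie_zero (L := ℂ ⊗[ℚ] 𝔏) (M := ℂ ⊗[ℚ] 𝔏) (a ⊗ₜ[ℚ] X)
        rw [h0, map_zero, mul_zero, zero_mul, sub_zero]
      | tmul b Y =>
        rw [LieAlgebra.ExtendScalars.bracket_tmul, hT₀tmul, hT₀tmul, hT₀tmul, LieSubalgebra.coe_bracket,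
          LieRing.of_associative_ring_bracket, LinearMap.baseChange_sub, LinearMap.baseChange_mul,
          LinearMap.baseChange_mul, smul_mul_smul_comm, smul_mul_smul_comm, mul_comm b a, smul_sub]
      | add v₁ v₂ h₁ h₂ =>
        have hadd : ⁅a ⊗ₜ[ℚ] X, v₁ + v₂⁆ = ⁅a ⊗ₜ[ℚ] X, v₁⁆ + ⁅a ⊗ₜ[ℚ] X, v₂⁆ :=
          lie_add (L := ℂ ⊗[ℚ] 𝔏) (M := ℂ ⊗[ℚ] 𝔏) (a ⊗ₜ[ℚ] X) v₁ v₂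
        rw [hadd, map_add, h₁, h₂, map_add, mul_add, add_mul]
        abel
    | add u₁ u₂ h₁ h₂ =>
      simp only [add_lie, map_add, h₁, h₂, add_mul, mul_add]
      abel
  -- the Lie homomorphism
  let T : (ℂ ⊗[ℚ] 𝔏) →ₗ⁅ℂ⁆ 𝔏' :=
    { (T₀.codRestrict 𝔏'.toSubmodule hT₀mem) with
      map_lie' := by
        intro u v
        apply Subtype.ext
        rw [LieSubalgebra.coe_bracket, LieRing.of_associative_ring_bracket]
        exact hlie u v }
  have hTapply : ∀ u, ((T u : 𝔏') : Module.End ℂ (ℂ ⊗[ℚ] V)) = T₀ u := fun u => rfl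
  have hTbij : Function.Bijective T := by
    constructor
    · intro u v h
      exact hT₀inj (by rw [← hTapply, ← hTapply, h])
    · intro Y
      obtain ⟨u, hu⟩ := hT₀surj Y
      exact ⟨u, Subtype.ext (by rw [hTapply, hu])⟩
  refine ⟨LieEquiv.ofBijective T hTbij, fun c X => ?_⟩
  change ((T (c ⊗ₜ[ℚ] X) : 𝔏') : Module.End ℂ (ℂ ⊗[ℚ] V)) = _
  rw [hTapply, hT₀tmul]

end HodgeStructure

end Literature.AlgebraicGeometry.Motives
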